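import Literature.AlgebraicGeometry.HodgeTheory.FermatHodgeConjecture
import HarnessLib

/-!
# The Hodge conjecture for Fermat fourfolds of degree coprime to `6`, and for Fermat varieties of degree `21`, `27` (da Silva 2021)

Family `hodge`, layer `Literature/AlgebraicGeometry/HodgeTheory`. Two further KNOWN CASES of the
Hodge conjecture for Fermat varieties, stated `B`-free on the real carriers exactly as the sibling
fact `hodgeClasses_algebraic_fermat` (Shioda 1979: `m` prime or `m ≤ 20`) of
`FermatHodgeConjecture.lean`, requested by route `HodgeConjecture/DerivedTorelliFermat`
(`route-HodgeConjecture-DerivedTorelliFermat`), whose target `FermatFourfoldsHC`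
(`stmt-HodgeConjecture-11118`) is the Hodge conjecture for ALL Fermat fourfolds: with these facts the
route's cruxes are needed only in degrees `m` with `gcd(m, 6) > 1` (and `m ∉ {21, 27}`, `m > 20`,
`m` not prime), the first being `m = 22, 24, 26, …` and the route's own `m = 33`.

Source, read 2026-08-15 in the held arXiv text (`paper:arxiv-2101.04739`, p. 6): G. da Silva Jr.,
*Notes on the Hodge Conjecture for Fermat Varieties*, Experimental Results 2 (2021),
doi:10.1017/exp.2021.14, arXiv:2101.04739, §3:

* **Lemma 3.2.** "Let `m` be an integer coprime to 6. a) (Shioda [S2]) `Hdg¹(X²ₘ)` is generated by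
  lines. b) (Aoki [aoki]) `Hdg¹(X¹ₘ × X¹ₘ)` is generated by lines."
* **Theorem 3.3.** "If `m` is coprime to `6`, then the Hodge conjecture is true for all Fermat
  fourfolds `X⁴ₘ`." ("Proof. By taking `m = 6` [sic: `n = 6`] and `r = s = 2` in theorem (shioda)
  [Shioda's inductive structure], the result follows directly from the lemma above.")
* **Theorem 3.5.** "The Hodge conjecture is true for Fermats `Xⁿ₂₁` and `Xⁿ₂₇`." ("We slightly
  extended Shioda's work by verifying condition `(Pₘ)` for `m = 21, 27`. A computational proof can
  be found in the Appendix" — SAGE code, Appendix p. 8.)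
* (context, NOT vendored) Prop. 3.1 (computational: `m ≤ 100` coprime to `6`), Prop. 3.6
  ("Condition `P₃₃` is false": the explicit non-quasi-decomposable cycle
  `(0,…,0,1,0,0,1,0,0,1,0,…,0,1,0,0,1,0,…,0,1,0,0,0,0,3)` on `X⁴₃₃` — the class of the route's crux
  `Fermat33AccidentalClass`), and Question 1 (the candidate codimension-`2` subvariety
  `W : p₁(x^d) = p₂(x^d) = p₃(x^d) = 0` for `m = 3d`, `3 ∤ d`).

CAVEAT recorded for users: the source is a short note in *Experimental Results*; the proof of
Thm. 3.3 is the two-line reduction quoted above to Shioda's inductive structure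
(Shioda 1979, Math. Ann. 245, Thm. I–II) and to Lemma 3.2 (Shioda, *On the Picard number of a
Fermat surface*, J. Fac. Sci. Univ. Tokyo 28 (1982) [S2]; Aoki, Amer. J. Math. 113 (1991)
779–833 [aoki]); Thm. 3.5 rests on a SAGE verification of Shioda's condition `(Pₘ)`. Both are
vendored as named facts (hypotheses `(h : …)`), not asserted. UPDATE 2026-08-15: the computational ingredient
of Thm. 3.5 — Shioda's condition `(P₂₁)`, `(P₂₇)` — is now PROVED in the tree by kernel-checked certificates,
`FermatCharacter.shiodaCondition_twentyOne` (file `FermatShiodaConditionTwentyOne`) and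
`FermatCharacter.shiodaCondition_twentySeven` (file `FermatShiodaConditionTwentySeven`), together with the
explicit Hilbert bases `hb21`, `hb27` of Shioda's semigroups (`φ(21) = 3`, `φ(27) = 5`, as in da Silva's table);
what the fact `daSilva2021_hodgeClasses_algebraic_fermat_21_27` still packages is Shioda's Theorem 1
("`(Pₘ) ⇒` the Hodge conjecture for `Xⁿₘ`, all `n`": the character decomposition of the Hodge classes and the
inductive structure on real cohomology, Shioda 1979), i.e. exactly the open geometric layers of the sibling
fact `hodgeClasses_algebraic_fermat` (module docstrings of `FermatShiodaCondition`,
`FermatHodgeConjectureAssembly`) — an ordinary proof, not a computation.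

## CORRECTION 2026-08-15: the version of record states `m ≤ 100`, not all `m` coprime to `6`

The bullets above transcribe the arXiv text **v2** (8 May 2021). The VERSION OF RECORD — Experimental
Results 2 (2021) e22, doi:10.1017/exp.2021.14, published online 16 July 2021 (open reviews dated
30 May and 17 June 2021), read 2026-08-15 on the publisher's page and in the Crossref record — does
NOT contain Lemma 3.2 / Theorem 3.3 / Corollary 3.4 of arXiv v2. Its §3 consists of Prop. 3.1
("If `m ≤ 100` is an integer coprime to 6, then the Hodge conjecture is true for all Fermat fourfolds
`X⁴ₘ`"), Cor. 3.2 (products of such fourfolds), Thm. 3.3 (= arXiv Thm. 3.5: `Xⁿ₂₁`, `Xⁿ₂₇`, all `n`),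
Prop. 3.4 (= arXiv Prop. 3.6: `(P₃₃)` is false), Question 1 and Prop. 3.5 (= arXiv Prop. 3.7), and
its abstract reads "We show the Hodge conjecture for Fermat fourfolds `X⁴ₘ` of degree `m ≤ 100`
coprime to 6, and also prove the conjecture for `Xⁿ₂₁` and `Xⁿ₂₇`, for all `n`."  Moreover the
two-line arXiv proof of the all-`m` statement does not go through: with `r = s = 2` the Hodge classes
of `[H²_prim(X²ₘ) ⊗ H²_prim(X²ₘ)]^{μₘ}` are not spanned by `Hdg¹ ⊗ Hdg¹` (types `(2,0) ⊗ (0,2)` occur),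
so the argument reaches only characters that are three pairs or two zero-sum triples, whereas for
every composite `m` with `5 ∣ m` the Hodge characters `σ_{5,a} = (a, a+d, …, a+4d, -5a)`, `d = m/5`
(Aoki's `5`-standard elements) are neither — kernel-checked in
`FermatFourfoldFiveStandardSextuples` (`FermatCharacter.not_shiodaConditionUpTo_twentyfive_four`,
`…thirtyfive_four`, `fiveStandard_hodge_not_decomposable_of_coprime_six`).  In print the all-`m`
statement is covered only for `(m, 30) = 1` (Aoki, Math. Ann. 266 (1983) Thm. A′ with Ran/Shioda),
prime powers (Aoki, J. Math. Soc. Japan 39 (1987) Cor. 2-3) and `m ≤ 100` (Prop. 3.1, whose proof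
is a SAGE enumeration of `𝔅⁴ₘ` — every element quasi-decomposable or of standard type;
re-enumerated independently 2026-08-15: three pairs, or `σ_{5,a}` when `5 ∣ m` — plus Shioda 1979
Thm. I, Ran/Shioda's planes and Aoki 1987 Thm. 2-1).  Hence the fact
`daSilva2021_hodgeClasses_algebraic_fermatFourfold_coprime_six` below is MIS-ATTRIBUTED as a
citation of doi:10.1017/exp.2021.14.  The statement the published source makes is the SAME
rendering with the extra hypothesis `m ≤ 100`:
`∀ m X, 1 < m → m ≤ 100 → Nat.Coprime m 6 → IsFermatVariety 4 m X → IsSmoothProjective 4 X →`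
(rational `(p,p)`-classes are in `algebraicClasses X p`), to be vendored as
`daSilva2021_hodgeClasses_algebraic_fermatFourfold_coprime_six_le_hundred`
[cite: daSilva2021HodgeFermat, Prop. 3.1 (version of record)] by a restating seat (the auditing
seat may not add named facts); it is WEAKER than the def below.  The old def is kept unchanged only
because it is referenced; new work must not consume it.

## Rendering (identical conventions to `hodgeClasses_algebraic_fermat`)

* `X` ranges over `ℂ`-schemes with `Motives.IsFermatVariety n m X ∧ Motives.IsSmoothProjective n X`;
  "the Hodge conjecture is true for `X`" is rendered by its CYCLE PART on real carriers — every
  rational class of Hodge type `(p, p)` in `H²ᵖ(X(ℂ); ℂ)` lies in `algebraicClasses X p`, for every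
  `p` (off the middle degree this is Lefschetz's theorem for hypersurfaces, as Shioda notes; the
  printed statements are for the whole variety, so all `p` are included, as in the sibling fact);
  the anti-vacuity conjunct `Nonempty (HodgeModel n X)` of `HodgeConjectureFor` is the separate fact
  `nonempty_hodgeModel`, combined in the proved corollaries below.
* Thm. 3.3: `n = 4`, `Nat.Coprime m 6`, and `1 < m` (da Silva's standing `m > 1`; `m = 1` is a
  hyperplane, excluded as outside the printed range although trivial).
* Thm. 3.5: `m = 21 ∨ m = 27`, every dimension `n`.

## References

* [daSilva2021HodgeFermat] G. da Silva Jr., Notes on the Hodge Conjecture for Fermat Varieties,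
  Experimental Results 2 (2021), doi:10.1017/exp.2021.14, arXiv:2101.04739, §3 Lemma 3.2,
  Thm. 3.3, Thm. 3.5, Prop. 3.6 (text read, p. 6 of the arXiv version).
* [Shioda1979HodgeFermat] T. Shioda, The Hodge conjecture for Fermat varieties, Math. Ann. 245
  (1979) 175–184, Thm. I–II (the inductive structure used in the proof of Thm. 3.3).
* [Shioda1979PJA] T. Shioda, Proc. Japan Acad. 55A (1979) 111–114 (condition `(Pₘ)`).
-/

noncomputable section

namespace Literature.AlgebraicGeometry.HodgeTheory

section HodgeTheory

/-- **The Hodge conjecture for Fermat fourfolds of degree coprime to `6` (da Silva 2021,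
Thm. 3.3), cycle part on real carriers**: "If `m` is coprime to `6`, then the Hodge conjecture is
true for all Fermat fourfolds `X⁴ₘ`" (from Shioda's inductive structure with `n = 6`, `r = s = 2`,
and Lemma 3.2: `Hdg¹(X²ₘ)` (Shioda) and `Hdg¹(X¹ₘ × X¹ₘ)` (Aoki) are generated by lines for
`(m, 6) = 1`). Rendering: for `X` a smooth projective `ℂ`-scheme of dimension `4` which is the
Fermat variety `x₀ᵐ + ⋯ + x₅ᵐ = 0 ⊂ ℙ⁵_ℂ` with `1 < m`, `Nat.Coprime m 6`, every rational class of
Hodge type `(p, p)` in `H²ᵖ(X(ℂ); ℂ)` lies in `algebraicClasses X p`. Grounds part of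
`Summit.HodgeConjecture.HodgeConjecture.Theses.DerivedTorelliFermat.FermatFourfoldsHC`
(the degrees coprime to `6`). Users take `(h : daSilva2021_hodgeClasses_algebraic_fermatFourfold_coprime_six)`.
STATUS (audit 2026-08-15, module docstring §CORRECTION): this all-`m` statement is Thm. 3.3 of
the arXiv text v2 ONLY — it is absent from the version of record (Experimental Results 2 (2021) e22),
whose Prop. 3.1 asserts it for `m ≤ 100`; the arXiv proof does not cover the classes `V(σ_{5,a})`,
`5 ∣ m` (certificates in `FermatFourfoldFiveStandardSextuples`), and no published proof of the
all-`m` statement is known to the tree (covered in print: `(m,30)=1`, prime powers, `m ≤ 100`).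
To be superseded by `daSilva2021_hodgeClasses_algebraic_fermatFourfold_coprime_six_le_hundred`
(the `m ≤ 100` statement); do not consume
`(h : daSilva2021_hodgeClasses_algebraic_fermatFourfold_coprime_six)` in new work.
[cite: daSilva2021HodgeFermat, Thm. 3.3 and Lemma 3.2 of the arXiv text v2 (p. 6), not in the version of record] -/
def daSilva2021_hodgeClasses_algebraic_fermatFourfold_coprime_six : Prop :=
  ∀ ⦃m : ℕ⦄ ⦃X : Motives.SchemeOver ℂ⦄, 1 < m → Nat.Coprime m 6 →
    Motives.IsFermatVariety 4 m X → Motives.IsSmoothProjective 4 X →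
      ∀ (p : ℕ) (c : Literature.AlgebraicTopology.SingularHomology.singularCohomology ℂ ℂ (Motives.ComplexPoints X) (2 * p)),
        IsRationalClass c → IsOfHodgeType 4 X (2 * p) p p c → c ∈ algebraicClasses X p

/-- **The Hodge conjecture for the Fermat varieties `Xⁿ₂₁` and `Xⁿ₂₇`, all `n` (da Silva 2021,
Thm. 3.5), cycle part on real carriers**: "The Hodge conjecture is true for Fermats `Xⁿ₂₁` and
`Xⁿ₂₇`" (Shioda's condition `(Pₘ)` for `m = 21, 27` — verified by computer in the source, PROVED in
the tree: `FermatCharacter.shiodaCondition_twentyOne`, `FermatCharacter.shiodaCondition_twentySeven`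
— combined with Shioda 1979 PJA Thm. 1, "`(Pₘ) ⇒` the conjecture in every dimension", whose geometric
proof is not in the tree). Rendering as in `hodgeClasses_algebraic_fermat` with the degree range
`m = 21 ∨ m = 27`. Users take `(h : daSilva2021_hodgeClasses_algebraic_fermat_21_27)`.
[cite: daSilva2021HodgeFermat, Thm. 3.5 (p. 6) of the arXiv text v2 = Thm. 3.3 of the version of record, and Appendix] [cite: Shioda1979PJA, §2 Thm. 1] -/
def daSilva2021_hodgeClasses_algebraic_fermat_21_27 : Prop :=
  ∀ ⦃n m : ℕ⦄ ⦃X : Motives.SchemeOver ℂ⦄, m = 21 ∨ m = 27 →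
    Motives.IsFermatVariety n m X → Motives.IsSmoothProjective n X →
      ∀ (p : ℕ) (c : Literature.AlgebraicTopology.SingularHomology.singularCohomology ℂ ℂ (Motives.ComplexPoints X) (2 * p)),
        IsRationalClass c → IsOfHodgeType n X (2 * p) p p c → c ∈ algebraicClasses X p

variable {n m : ℕ} {X : Motives.SchemeOver ℂ}

/-- The Hodge conjecture for all smooth projective varieties implies the fourfold statement (an
instance family), so nothing stronger than the summit is claimed. [cite: Deligne2000, §1] -/
theorem daSilva2021_fermatFourfold_coprime_six_of_hodgeConjectureFor
    (h : ∀ ⦃n : ℕ⦄ ⦃X : Motives.SchemeOver ℂ⦄, Motives.IsSmoothProjective n X → HodgeConjectureFor n X) :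
    daSilva2021_hodgeClasses_algebraic_fermatFourfold_coprime_six :=
  fun _ _ _ _ _ hX p c hc hpp ↦ (h hX).2 p c hc hpp

/-- Likewise for degrees `21`, `27`. [cite: Deligne2000, §1] -/
theorem daSilva2021_fermat_21_27_of_hodgeConjectureFor
    (h : ∀ ⦃n : ℕ⦄ ⦃X : Motives.SchemeOver ℂ⦄, Motives.IsSmoothProjective n X → HodgeConjectureFor n X) :
    daSilva2021_hodgeClasses_algebraic_fermat_21_27 :=
  fun _ _ _ _ _ hX p c hc hpp ↦ (h hX).2 p c hc hpp

/-- **`HodgeConjectureFor 4 X` for Fermat fourfolds of degree coprime to `6`** from the fact and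
the existence of Hodge models (`nonempty_hodgeModel`, the anti-vacuity conjunct).
(STATUS 2026-08-15: the hypothesis `h` is the mis-attributed all-`m` fact — module docstring
§CORRECTION; only its `m ≤ 100` restriction is stated by the version of record.)
[cite: daSilva2021HodgeFermat, Thm. 3.3 (p. 6)] [cite: Deligne2000, §1] -/
theorem hodgeConjectureFor_fermatFourfold_coprime_six_of
    (h : daSilva2021_hodgeClasses_algebraic_fermatFourfold_coprime_six)
    (hA : nonempty_hodgeModel 4 X) (hm : 1 < m) (h6 : Nat.Coprime m 6)
    (hF : Motives.IsFermatVariety 4 m X) (hX : Motives.IsSmoothProjective 4 X) :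
    HodgeConjectureFor 4 X :=
  ⟨hA hX, fun p c hc hpp ↦ h hm h6 hF hX p c hc hpp⟩

/-- **`HodgeConjectureFor n X` for the Fermat varieties of degree `21` or `27`** from the fact and
the existence of Hodge models. [cite: daSilva2021HodgeFermat, Thm. 3.5 (p. 6)] [cite: Deligne2000, §1] -/
theorem hodgeConjectureFor_fermat_21_27_of (h : daSilva2021_hodgeClasses_algebraic_fermat_21_27)
    (hA : nonempty_hodgeModel n X) (hm : m = 21 ∨ m = 27) (hF : Motives.IsFermatVariety n m X)
    (hX : Motives.IsSmoothProjective n X) : HodgeConjectureFor n X :=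
  ⟨hA hX, fun p c hc hpp ↦ h hm hF hX p c hc hpp⟩

end HodgeTheory

end Literature.AlgebraicGeometry.HodgeTheory

end
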